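import Literature.Geometry.Kaehler.ComplexTorusKleimanLefschetzOperators
import HarnessLib

/-!
# The inverse of the hard Lefschetz isomorphism of a polarised complex torus is a polynomial in `L` and `ᶜΛ`:
# `(Lᵗ : H^{d-t} ⥲ H^{d+t})⁻¹ = Λᵗ` (Milne 1999, Rem. 5.11 / Scholl 1994, (5.9.1), read in cohomology)

Layer `Literature/Geometry/Kaehler`, namespace `Literature.Geometry.Kaehler.ComplexTorus`; lane
`lit-hodgefound` (Track 2 foundations library), Layer A4, prover seat `lit-hodgefound-p08` (generation 7,
row g7-#3 «Q633⁺ · A4-24⁺⁺ · A4-49⁺»). Sequel of `ComplexTorusKleimanLefschetzOperators.lean` (row Q633: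
Kleiman's `Λ = kleimanDual η m : H^{m+2}(X, ℂ) → Hᵐ(X, ℂ)` as a polynomial in `L` and `ᶜΛ` on the invariant
forms `Hᵐ(X, ℂ) = Alt^m_ℝ(E; ℂ)` of the complex torus `X = E/Λ` with a non-degenerate real `2`-form `η`,
`g = dim_ℂ E`; `kleimanDual_lefschetzPow_succ_of_mem_primitiveForms` (`Λ(L^{r+1}α) = Lʳα` on Milne's range),
`linearMap_ext_of_lefschetzPow`, `lefschetzPow_bijective_of_add_eq`, the `ℚ`-structure / Hodge-class /
equivariance statements `kleimanDual_apply_mem_rationalForms` / `_hodgeClasses` /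
`kleimanDual_compContinuousLinearMap`), all consumed BY NAME.

Sources followed (held copies, pages opened).

* J. S. Milne, *Lefschetz classes on abelian varieties*, Duke Math. J. **96** (1999) 639–675, held
  `paper:doi-10-1215-s0012-7094-99-09620-5`, p. 665 (p0027 L5–L6): "`Λ`, regarded as a map of cohomology
  groups, is inverse to `L`"; **Remark 5.11** (p0027 L65–L79), verbatim: "The referee points out that it is
  possible to show similarly that the correspondences `Λ`, `ᶜΛ`, `∗` etc. are Lefschetz for rational
  equivalence. Following (Scholl 1994, 5.9), define for `0 ≤ i ≤ 2g`,
  `fᵢ = Σ_{max(0,i-g) ≤ j ≤ i/2} 1/(j!(g-i+j)!(i-2j)!) p^*([Dʲ]) · q^*([Dʲ]) · [M]^{i-2j}`. Then `fᵢ` is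
  Lefschetz, and `√(-1)^i deg(λ_D) fᵢ` is the inverse of the strong Lefschetz isomorphism "cup with
  `[D]^{g-i}`" (cf. ib. 5.9.1)."
* C. Voisin, *Hodge Theory and Complex Algebraic Geometry I* (2002), §11.3.3 p. 287 (quoted in row A4-49's
  `ComplexTorusCorrespondenceOfOperator.lean`): "another example of a morphism of (rational) Hodge
  structures … is given by the inverse `(L^{n-k})^{-1}` of the Lefschetz isomorphisms".
* S. L. Kleiman, *Algebraic cycles and the Weil conjectures* (1968), §1.4 — not held, used through Milne.

## What is formalised (TORUS level, cohomological)

For the cycle-level statement of Rem. 5.11 (Scholl's `fᵢ`, rational equivalence, the constant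
`√(-1)^i deg(λ_D)`) read in cohomology on the invariant forms of `X`: the inverse of the hard Lefschetz
isomorphism `Lᵗ : H^{g-t}(X) ⥲ H^{g+t}(X)` is the `t`-fold iterate of Kleiman's `Λ` — hence an explicit
element of Milne's algebra `ℚ[L, ᶜΛ]`, defined over `ℚ`, mapping Hodge classes to Hodge classes (Voisin's
"morphism of rational Hodge structures", here with a formula) and commuting with every automorphism of
`(E, η)`.

* `kleimanDualPow η m t : H^{m+2t}(X, ℂ) →ₗ[ℂ] Hᵐ(X, ℂ)` — `Λᵗ = Λ ∘ ⋯ ∘ Λ` (recursion on `t`;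
  `kleimanDualPow_zero`, `kleimanDualPow_succ_apply`).
* **`kleimanDualPow_lefschetzPow_add_of_mem_primitiveForms`**: `Λᵗ(L^{r+t}β) = Lʳβ` for `β` primitive whenever
  the top summand `L^{r+t}P` of `H^{m+2t}` is in Milne's range (`m + t ≤ g + r`).
* **`kleimanDualPow_comp_lefschetzPow`: `Λᵗ ∘ Lᵗ = id` on `Hᵐ` for `m + t ≤ g`**, pointwise
  `kleimanDualPow_lefschetzPow`; **`lefschetzPow_comp_kleimanDualPow`: `Lᵗ ∘ Λᵗ = id` on `H^{m+2t}` for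
  `m + t = g`**, pointwise `lefschetzPow_kleimanDualPow`; **`eq_kleimanDualPow_of_leftInverse`** (EVERY left
  inverse `u` of `Lᵗ : H^{g-t} → H^{g+t}` — the `u` of row A4-49's `corrClass_lefschetzInv_mem_hodgeClasses` —
  IS `Λᵗ`) and `kleimanDualPow_bijective` (`m + t = g`).
* `kleimanDualPow_apply_mem_rationalForms`, `kleimanDualPow_apply_mem_hodgeClasses` (the inverse Lefschetz
  isomorphism is defined over `ℚ` and maps `H^{2(p+t)}_Hodge` to `H^{2p}_Hodge`),
  `kleimanDualPow_compContinuousLinearMap` (it commutes with every automorphism `T` of `(E, η)`).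

* `∗` ABOVE THE MIDDLE DEGREE: **`lefschetzStarInv η m j := (Σ_r ε_r π_{m,r}) ∘ Λʲ : H^{m+2j} → Hᵐ`** (`m + j = d`),
  Milne's `∗x = Σ_{i ≥ s-d} ε(s - 2i) L^{d-s+i}xᵢ` on `Hˢ`, `s = 2d - m ≥ d`, as a polynomial in `L`, `ᶜΛ`:
  **`lefschetzStarInv_lefschetzPow_add_of_mem_primitiveForms`** (`∗(L^{r+j}α) = ε(k) Lʳα`),
  **`lefschetzStar_comp_lefschetzStarInv`**, **`lefschetzStarInv_comp_lefschetzStar`** (`∗∗ = id` in both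
  orders, with row Q633's `lefschetzStar`), `lefschetzStarInv_bijective`, `lefschetzStarInv_compContinuousLinearMap`,
  `lefschetzStarInv_apply_mem_rationalForms` / `_hodgeClasses`.

Not here: Scholl's cycles `fᵢ` and rational equivalence; the normalising constant (a cycle-level artefact:
in cohomology `Λᵗ Lᵗ = id` exactly).

Two definitions with bodies (`kleimanDualPow`, `lefschetzStarInv`); theorems otherwise; NO named fact (net debt 0).

## References

* [Milne1999LefschetzClasses] J. S. Milne, *Lefschetz classes on abelian varieties*, Duke Math. J. 96
  (1999), 639–675: §5 Rem. 5.11, proof of Thm. 5.9 (p. 665).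
* [Scholl1994ClassicalMotives] A. J. Scholl, *Classical motives*, in: Motives (Seattle 1991), Proc. Symp.
  Pure Math. 55.1 (1994): §5, (5.9.1) (as quoted by Milne).
* [Kleiman1968AlgebraicCycles] S. L. Kleiman, *Algebraic cycles and the Weil conjectures* (1968), §1.4.
* [Voisin2002] C. Voisin, *Hodge Theory and Complex Algebraic Geometry I* (2002), §11.3.3 p. 287.
-/

noncomputable section

set_option maxSynthPendingDepth 3

open scoped Manifold ContDiff
open Module Finset

namespace Literature.Geometry.Kaehler

namespace ComplexTorus

section InverseLefschetz

variable {E : Type*} [NormedAddCommGroup E] [NormedSpace ℂ E] [FiniteDimensional ℂ E]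

omit [FiniteDimensional ℂ E] in
/-- `Lʳ` with propositionally equal exponents. [folklore] -/
private theorem lefschetzPow_congr' (η : E [⋀^Fin 2]→L[ℝ] ℝ) {r r' : ℕ} (hr : r = r') {m k : ℕ}
    (h : 2 * r + m = k) (h' : 2 * r' + m = k) (ψ : E [⋀^Fin m]→L[ℝ] ℂ) :
    lefschetzPow η r h ψ = lefschetzPow η r' h' ψ := by
  subst hr
  rfl

/-- **The `t`-fold iterate `Λᵗ : H^{m+2t}(X, ℂ) → Hᵐ(X, ℂ)` of Kleiman's dual Lefschetz operator** — the
cohomological inverse of the hard Lefschetz isomorphism `Lᵗ` (Milne 1999, Rem. 5.11: "`√(-1)^i deg(λ_D) fᵢ`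
is the inverse of the strong Lefschetz isomorphism 'cup with `[D]^{g-i}`'"; "`Λ` … is inverse to `L`"), an
explicit polynomial in `L` and `ᶜΛ`. [cite: Milne1999LefschetzClasses, §5 Rem. 5.11]
[cite: Kleiman1968AlgebraicCycles, §1.4] -/
def kleimanDualPow (η : E [⋀^Fin 2]→L[ℝ] ℝ) (m : ℕ) :
    (t : ℕ) → ((E [⋀^Fin (m + 2 * t)]→L[ℝ] ℂ) →ₗ[ℂ] (E [⋀^Fin m]→L[ℝ] ℂ))
  | 0 => LinearMap.id
  | t + 1 => kleimanDualPow η m t ∘ₗ kleimanDual η (m + 2 * t)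

/-- `Λ⁰ = id`. [cite: Milne1999LefschetzClasses, §5 Rem. 5.11] -/
theorem kleimanDualPow_zero (η : E [⋀^Fin 2]→L[ℝ] ℝ) (m : ℕ) (x : E [⋀^Fin m]→L[ℝ] ℂ) :
    kleimanDualPow η m 0 x = x := rfl

/-- `Λᵗ⁺¹ = Λᵗ ∘ Λ`. [cite: Milne1999LefschetzClasses, §5 Rem. 5.11] -/
theorem kleimanDualPow_succ_apply (η : E [⋀^Fin 2]→L[ℝ] ℝ) (m t : ℕ)
    (x : E [⋀^Fin (m + 2 * t + 2)]→L[ℝ] ℂ) :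
    kleimanDualPow η m (t + 1) x = kleimanDualPow η m t (kleimanDual η (m + 2 * t) x) := rfl

variable {η : E [⋀^Fin 2]→L[ℝ] ℝ} (hη : ∀ v : E, v ≠ 0 → ∃ w : E, η ![v, w] ≠ 0)

include hη

/-- **`Λᵗ(L^{r+t}β) = Lʳβ` for `β` primitive**, whenever the top summand `L^{r+t}Pᵏ ⊂ H^{m+2t}` lies in
Milne's range (`m + t ≤ g + r`, i.e. `k + r + t ≤ g` for `2r + k = m`): each `Λ` peels off one `L`
(row Q633 `kleimanDual_lefschetzPow_succ_of_mem_primitiveForms`). [cite: Milne1999LefschetzClasses, §5 Rem. 5.11, p. 665] -/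
theorem kleimanDualPow_lefschetzPow_add_of_mem_primitiveForms {m r k : ℕ} (h : 2 * r + k = m)
    {β : E [⋀^Fin k]→L[ℝ] ℂ} (hβ : β ∈ primitiveForms η k) :
    ∀ (t : ℕ), m + t ≤ finrank ℂ E + r → ∀ (h' : 2 * (r + t) + k = m + 2 * t),
      kleimanDualPow η m t (lefschetzPow η (r + t) h' β) = lefschetzPow η r h β
  | 0, _, h' => by
    rw [kleimanDualPow_zero]
    exact lefschetzPow_congr' η (Nat.add_zero r) h' h β
  | t + 1, hrt, h' => by
    rw [kleimanDualPow_succ_apply, lefschetzPow_congr' η (show r + (t + 1) = (r + t) + 1 by omega) h'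
        (show 2 * ((r + t) + 1) + k = m + 2 * t + 2 by omega),
      kleimanDual_lefschetzPow_succ_of_mem_primitiveForms hη (by omega) _
        (show 2 * (r + t) + k = m + 2 * t by omega) hβ]
    exact kleimanDualPow_lefschetzPow_add_of_mem_primitiveForms h hβ t (by omega) _

/-- **`Λᵗ ∘ Lᵗ = id` on `Hᵐ(X, ℂ)` for `m + t ≤ g`** ("`Λ`, regarded as a map of cohomology groups, is
inverse to `L`", iterated below the middle degree). [cite: Milne1999LefschetzClasses, §5 p. 665, Rem. 5.11] -/
theorem kleimanDualPow_comp_lefschetzPow {m t : ℕ} (hmt : m + t ≤ finrank ℂ E) (h : 2 * t + m = m + 2 * t) :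
    kleimanDualPow η m t ∘ₗ lefschetzPow η t h = LinearMap.id := by
  refine linearMap_ext_of_lefschetzPow hη (by omega) fun r k hk _ β hβ ↦ ?_
  rw [LinearMap.comp_apply, LinearMap.id_apply, lefschetzPow_lefschetzPow,
    lefschetzPow_congr' η (Nat.add_comm t r) _ (show 2 * (r + t) + k = m + 2 * t by omega)]
  exact kleimanDualPow_lefschetzPow_add_of_mem_primitiveForms hη hk hβ t (by omega) _

/-- `Λᵗ(Lᵗ y) = y` for `y ∈ Hᵐ`, `m + t ≤ g`. [cite: Milne1999LefschetzClasses, §5 Rem. 5.11] -/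
theorem kleimanDualPow_lefschetzPow {m t : ℕ} (hmt : m + t ≤ finrank ℂ E) (h : 2 * t + m = m + 2 * t)
    (y : E [⋀^Fin m]→L[ℝ] ℂ) : kleimanDualPow η m t (lefschetzPow η t h y) = y := by
  have := LinearMap.congr_fun (kleimanDualPow_comp_lefschetzPow hη hmt h) y
  rwa [LinearMap.comp_apply, LinearMap.id_apply] at this

/-- **THE INVERSE OF THE HARD LEFSCHETZ ISOMORPHISM IS `Λᵗ`: `Lᵗ ∘ Λᵗ = id` on `H^{m+2t}(X, ℂ)` for
`m + t = g`** (`Lᵗ : Hᵐ ⥲ H^{m+2t}` is bijective, row A4-24⁺, and `Λᵗ` is its left inverse) — Milne's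
Rem. 5.11 "… is the inverse of the strong Lefschetz isomorphism 'cup with `[D]^{g-i}`'" read in cohomology.
[cite: Milne1999LefschetzClasses, §5 Rem. 5.11] [cite: Voisin2002, §11.3.3 p. 287] -/
theorem lefschetzPow_comp_kleimanDualPow {m t : ℕ} (hmt : m + t = finrank ℂ E) (h : 2 * t + m = m + 2 * t) :
    lefschetzPow η t h ∘ₗ kleimanDualPow η m t = LinearMap.id := by
  have hbij := lefschetzPow_bijective_of_add_eq hη hmt h
  refine LinearMap.ext fun x ↦ ?_
  obtain ⟨y, rfl⟩ := hbij.2 x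
  rw [LinearMap.comp_apply, LinearMap.id_apply, kleimanDualPow_lefschetzPow hη hmt.le h]

/-- `Lᵗ(Λᵗ x) = x` for `x ∈ H^{m+2t}`, `m + t = g`. [cite: Milne1999LefschetzClasses, §5 Rem. 5.11] -/
theorem lefschetzPow_kleimanDualPow {m t : ℕ} (hmt : m + t = finrank ℂ E) (h : 2 * t + m = m + 2 * t)
    (x : E [⋀^Fin (m + 2 * t)]→L[ℝ] ℂ) : lefschetzPow η t h (kleimanDualPow η m t x) = x := by
  have := LinearMap.congr_fun (lefschetzPow_comp_kleimanDualPow hη hmt h) x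
  rwa [LinearMap.comp_apply, LinearMap.id_apply] at this

/-- `Λᵗ : H^{g+t} → H^{g-t}` is bijective (`m + t = g`). [cite: Milne1999LefschetzClasses, §5 Rem. 5.11] -/
theorem kleimanDualPow_bijective {m t : ℕ} (hmt : m + t = finrank ℂ E) :
    Function.Bijective (kleimanDualPow η m t) := by
  have h : 2 * t + m = m + 2 * t := by omega
  have hl : Function.LeftInverse (lefschetzPow η t h) (kleimanDualPow η m t) :=
    lefschetzPow_kleimanDualPow hη hmt h
  have hr : Function.RightInverse (lefschetzPow η t h) (kleimanDualPow η m t) :=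
    kleimanDualPow_lefschetzPow hη hmt.le h
  exact ⟨hl.injective, hr.surjective⟩

/-- **Every left inverse of the hard Lefschetz isomorphism is `Λᵗ`**: if `u ∘ Lᵗ = id` on `Hᵐ`, `m + t = g`
(the `u` of row A4-49's `corrClass_lefschetzInv_mem_hodgeClasses`), then `u = Λᵗ` — so that inverse is an
explicit polynomial in `L` and `ᶜΛ`. [cite: Milne1999LefschetzClasses, §5 Rem. 5.11] [cite: Voisin2002, §11.3.3 p. 287] -/
theorem eq_kleimanDualPow_of_leftInverse {m t : ℕ} (hmt : m + t = finrank ℂ E) (h : 2 * t + m = m + 2 * t)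
    (u : (E [⋀^Fin (m + 2 * t)]→L[ℝ] ℂ) →ₗ[ℂ] (E [⋀^Fin m]→L[ℝ] ℂ))
    (hu : ∀ y, u (lefschetzPow η t h y) = y) : u = kleimanDualPow η m t := by
  refine LinearMap.ext fun x ↦ ?_
  obtain ⟨y, rfl⟩ := (lefschetzPow_bijective_of_add_eq hη hmt h).2 x
  rw [hu, kleimanDualPow_lefschetzPow hη hmt.le h]

/-- **`Λᵗ` commutes with every automorphism `T` of `(E, η)`**: `Λᵗ(T^*x) = T^*(Λᵗx)` (row Q633
`kleimanDual_compContinuousLinearMap`, iterated). [cite: Milne1999LefschetzClasses, §5 proof of Thm. 5.9, Rem. 5.11] -/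
theorem kleimanDualPow_compContinuousLinearMap (T : E ≃L[ℝ] E) (hT : ∀ u v : E, η ![T u, T v] = η ![u, v])
    (m : ℕ) : ∀ (t : ℕ) (x : E [⋀^Fin (m + 2 * t)]→L[ℝ] ℂ),
      kleimanDualPow η m t (x.compContinuousLinearMap (T : E →L[ℝ] E)) =
        (kleimanDualPow η m t x).compContinuousLinearMap (T : E →L[ℝ] E)
  | 0, x => by rw [kleimanDualPow_zero, kleimanDualPow_zero]
  | t + 1, x => by
    rw [kleimanDualPow_succ_apply, kleimanDualPow_succ_apply, kleimanDual_compContinuousLinearMap hη T hT,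
      kleimanDualPow_compContinuousLinearMap T hT m t]

end InverseLefschetz

/-! ### `∗` above the middle degree: `∗ = (Σ_r ε_r π_{m,r}) ∘ Λʲ : H^{2d-m} → Hᵐ`, the inverse of `∗ : Hᵐ → H^{2d-m}` -/

section StarInv

variable {E : Type*} [NormedAddCommGroup E] [NormedSpace ℂ E] [FiniteDimensional ℂ E]

/-- **Kleiman's `∗` on the degrees above the middle, `∗ : Hˢ(X) → H^{2d-s}(X)` for `s = m + 2j ≥ d`
(`m + j = d`), `∗x = Σ_{i ≥ s-d} (-1)^{(s-2i)(s-2i+1)/2} L^{d-s+i}xᵢ`** (Milne 1999, p. 664, the sums starting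
at `i = s - d = j`), AS A POLYNOMIAL IN `L` AND `ᶜΛ`: the sign operator of row Q633 after the `j`-fold
Kleiman `Λ` (`L^{d-s+i}xᵢ = L^{i-j}xᵢ = Λʲ(Lⁱxᵢ)`). It is the inverse of row Q633's `lefschetzStar η j`
(`lefschetzStar_comp_lefschetzStarInv`, `lefschetzStarInv_comp_lefschetzStar`): `∗∗ = id`.
[cite: Milne1999LefschetzClasses, §5 p. 664 (display defining ∗)] [cite: Kleiman1968AlgebraicCycles, §1.4 (1.4.4)] -/
def lefschetzStarInv (η : E [⋀^Fin 2]→L[ℝ] ℝ) (m j : ℕ) :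
    (E [⋀^Fin (m + 2 * j)]→L[ℝ] ℂ) →ₗ[ℂ] (E [⋀^Fin m]→L[ℝ] ℂ) :=
  lefschetzSignOp η m ∘ₗ kleimanDualPow η m j

/-- `∗x = (Σ_r ε_r π_{m,r})(Λʲx)` above the middle degree. [cite: Milne1999LefschetzClasses, §5 p. 664] -/
theorem lefschetzStarInv_apply (η : E [⋀^Fin 2]→L[ℝ] ℝ) (m j : ℕ) (x : E [⋀^Fin (m + 2 * j)]→L[ℝ] ℂ) :
    lefschetzStarInv η m j x = lefschetzSignOp η m (kleimanDualPow η m j x) := rfl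

variable {η : E [⋀^Fin 2]→L[ℝ] ℝ} (hη : ∀ v : E, v ≠ 0 → ∃ w : E, η ![v, w] ≠ 0)

include hη

/-- **MILNE'S DISPLAY FOR `∗` ABOVE THE MIDDLE DEGREE**: for `s = m + 2j`, `m + j = d`, `α ∈ Pᵏ`,
`2r + k = m`: `∗(L^{r+j}α) = (-1)^{k(k+1)/2} Lʳα` (`i = r + j ≥ s - d = j`, `s - 2i = k`, `d - s + i = r`).
[cite: Milne1999LefschetzClasses, §5 p. 664 (display defining ∗, `i ≥ s - d`)] -/
theorem lefschetzStarInv_lefschetzPow_add_of_mem_primitiveForms {m j r k : ℕ} (hmj : m + j = finrank ℂ E)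
    (h : 2 * r + k = m) (h' : 2 * (r + j) + k = m + 2 * j) {α : E [⋀^Fin k]→L[ℝ] ℂ}
    (hα : α ∈ primitiveForms η k) :
    lefschetzStarInv η m j (lefschetzPow η (r + j) h' α) = (lefschetzSign k : ℂ) • lefschetzPow η r h α := by
  rw [lefschetzStarInv_apply, kleimanDualPow_lefschetzPow_add_of_mem_primitiveForms hη h hα j (by omega) h',
    lefschetzSignOp_lefschetzPow_of_mem_primitiveForms hη h (by omega) hα]

/-- **`∗ ∘ ∗ = id` on `H^{2d-m}(X)`**: row Q633's `∗ : Hᵐ → H^{2d-m}` after the `∗` above the middle degree is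
the identity (`m + j = d`). [cite: Milne1999LefschetzClasses, §5 p. 664] [cite: Kleiman1968AlgebraicCycles, §1.4 (1.4.4)] -/
theorem lefschetzStar_comp_lefschetzStarInv {m j : ℕ} (hmj : m + j = finrank ℂ E) (h : 2 * j + m = m + 2 * j) :
    lefschetzStar η j h ∘ₗ lefschetzStarInv η m j = LinearMap.id := by
  refine LinearMap.ext fun x ↦ ?_
  rw [LinearMap.comp_apply, LinearMap.id_apply, lefschetzStarInv_apply, lefschetzStar_apply,
    ← Module.End.mul_apply, lefschetzSignOp_mul_self hη (by omega), Module.End.one_apply,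
    lefschetzPow_kleimanDualPow hη hmj h]

/-- **`∗ ∘ ∗ = id` on `Hᵐ(X)`**: the `∗` above the middle degree after row Q633's `∗ : Hᵐ → H^{2d-m}` is the
identity (`m + j = d`). [cite: Milne1999LefschetzClasses, §5 p. 664] [cite: Kleiman1968AlgebraicCycles, §1.4 (1.4.4)] -/
theorem lefschetzStarInv_comp_lefschetzStar {m j : ℕ} (hmj : m + j = finrank ℂ E) (h : 2 * j + m = m + 2 * j) :
    lefschetzStarInv η m j ∘ₗ lefschetzStar η j h = LinearMap.id := by
  refine LinearMap.ext fun y ↦ ?_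
  rw [LinearMap.comp_apply, LinearMap.id_apply, lefschetzStarInv_apply, lefschetzStar_apply,
    kleimanDualPow_lefschetzPow hη hmj.le h, ← Module.End.mul_apply, lefschetzSignOp_mul_self hη (by omega),
    Module.End.one_apply]

/-- `∗ : H^{2d-m} → Hᵐ` is bijective (`m + j = d`). [cite: Milne1999LefschetzClasses, §5 p. 664] -/
theorem lefschetzStarInv_bijective {m j : ℕ} (hmj : m + j = finrank ℂ E) :
    Function.Bijective (lefschetzStarInv η m j) := by
  have h : 2 * j + m = m + 2 * j := by omega
  have hl : Function.LeftInverse (lefschetzStar η j h) (lefschetzStarInv η m j) := fun x ↦ by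
    have := LinearMap.congr_fun (lefschetzStar_comp_lefschetzStarInv hη hmj h) x
    rwa [LinearMap.comp_apply, LinearMap.id_apply] at this
  have hr : Function.RightInverse (lefschetzStar η j h) (lefschetzStarInv η m j) := fun y ↦ by
    have := LinearMap.congr_fun (lefschetzStarInv_comp_lefschetzStar hη hmj h) y
    rwa [LinearMap.comp_apply, LinearMap.id_apply] at this
  exact ⟨hl.injective, hr.surjective⟩

/-- **`∗` above the middle degree commutes with every automorphism `T` of `(E, η)`.**
[cite: Milne1999LefschetzClasses, §5 proof of Thm. 5.9] -/
theorem lefschetzStarInv_compContinuousLinearMap (T : E ≃L[ℝ] E) (hT : ∀ u v : E, η ![T u, T v] = η ![u, v])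
    (m j : ℕ) (x : E [⋀^Fin (m + 2 * j)]→L[ℝ] ℂ) :
    lefschetzStarInv η m j (x.compContinuousLinearMap (T : E →L[ℝ] E)) =
      (lefschetzStarInv η m j x).compContinuousLinearMap (T : E →L[ℝ] E) := by
  rw [lefschetzStarInv_apply, lefschetzStarInv_apply, kleimanDualPow_compContinuousLinearMap hη T hT,
    lefschetzSignOp, LinearMap.sum_apply, LinearMap.sum_apply]
  simp only [LinearMap.smul_apply, primitiveProj_compContinuousLinearMap hη T hT]
  ext v
  simp only [ContinuousAlternatingMap.sum_apply, ContinuousAlternatingMap.smul_apply,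
    ContinuousAlternatingMap.compContinuousLinearMap_apply]

end StarInv

/-! ### Over `ℚ` and on Hodge classes -/

section Rational

variable {ι : Type*} [Fintype ι] {E : Type*} [NormedAddCommGroup E] [NormedSpace ℂ E]
  [FiniteDimensional ℂ E] (Φ : (ι → ℝ) ≃L[ℝ] E) {η : E [⋀^Fin 2]→L[ℝ] ℝ}

/-- **`Λᵗ` is defined over `ℚ`**: `Λᵗ(H^{m+2t}(X, ℚ)) ⊆ Hᵐ(X, ℚ)`; for `m + t = g` this says that the
inverse of the hard Lefschetz isomorphism is defined over `ℚ` (Voisin: "`Lᵏ` acts on the integral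
cohomology … the inverse `(L^{n-k})^{-1}` … morphism of rational Hodge structures").
[cite: Voisin2002, §11.3.3 p. 287] [cite: Milne1999LefschetzClasses, §5 Rem. 5.11] -/
theorem kleimanDualPow_apply_mem_rationalForms (hη : IsNSForm Φ η)
    (hnd : ∀ v : E, v ≠ 0 → ∃ w : E, η ![v, w] ≠ 0) (m : ℕ) :
    ∀ (t : ℕ) {x : E [⋀^Fin (m + 2 * t)]→L[ℝ] ℂ}, x ∈ rationalForms Φ (m + 2 * t) →
      kleimanDualPow η m t x ∈ rationalForms Φ m
  | 0, _, hx => hx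
  | t + 1, _, hx => by
    rw [kleimanDualPow_succ_apply]
    exact kleimanDualPow_apply_mem_rationalForms hη hnd m t (kleimanDual_apply_mem_rationalForms Φ hη hnd hx)

/-- Kleiman's `Λ` on the degree-flexible Hodge classes: `Λ(hodgeClassesIn (m+2) (p+1)) ⊆ hodgeClassesIn m p`
(row Q633 `kleimanDual_apply_mem_hodgeClasses` in degree `m = 2p`; off the diagonal both sides are `0`).
[cite: Voisin2002, §6.2.3 Rem. 6.27] [cite: Milne1999LefschetzClasses, §5 p. 665] -/
theorem kleimanDual_apply_mem_hodgeClassesIn (hη : IsNSForm Φ η)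
    (hnd : ∀ v : E, v ≠ 0 → ∃ w : E, η ![v, w] ≠ 0) {m p : ℕ} {x : E [⋀^Fin (m + 2)]→L[ℝ] ℂ}
    (hx : x ∈ hodgeClassesIn Φ (m + 2) (p + 1)) : kleimanDual η m x ∈ hodgeClassesIn Φ m p := by
  by_cases hm : m = 2 * p
  · subst hm
    exact kleimanDual_apply_mem_hodgeClasses Φ hη hnd (p := p) hx
  · rw [hodgeClassesIn_eq_bot_of_ne Φ (show (p + 1) + (p + 1) ≠ m + 2 by omega), Submodule.mem_bot] at hx
    rw [hx, map_zero]
    exact Submodule.zero_mem _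

/-- `Λᵗ(hodgeClassesIn (m + 2t) (p + t)) ⊆ hodgeClassesIn m p`. [cite: Voisin2002, §11.3.3 p. 287] -/
theorem kleimanDualPow_apply_mem_hodgeClassesIn (hη : IsNSForm Φ η)
    (hnd : ∀ v : E, v ≠ 0 → ∃ w : E, η ![v, w] ≠ 0) (m p : ℕ) :
    ∀ (t : ℕ) {x : E [⋀^Fin (m + 2 * t)]→L[ℝ] ℂ}, x ∈ hodgeClassesIn Φ (m + 2 * t) (p + t) →
      kleimanDualPow η m t x ∈ hodgeClassesIn Φ m p
  | 0, _, hx => hx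
  | t + 1, _, hx => by
    rw [kleimanDualPow_succ_apply]
    exact kleimanDualPow_apply_mem_hodgeClassesIn hη hnd m p t
      (kleimanDual_apply_mem_hodgeClassesIn Φ hη hnd hx)

/-- **`Λᵗ` maps Hodge classes to Hodge classes**: `Λᵗ(H^{2(p+t)}_Hodge(X)) ⊆ H^{2p}_Hodge(X)` (the source
read in degree `2p + 2t`); for `2p + t = g` the inverse of the hard Lefschetz isomorphism
`Lᵗ : H^{2p}(X) ⥲ H^{2g-2p}(X)` is a morphism of Hodge structures with an explicit formula.
[cite: Voisin2002, §11.3.3 p. 287] [cite: Milne1999LefschetzClasses, §5 Rem. 5.11] -/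
theorem kleimanDualPow_apply_mem_hodgeClasses (hη : IsNSForm Φ η)
    (hnd : ∀ v : E, v ≠ 0 → ∃ w : E, η ![v, w] ≠ 0) (p t : ℕ) {x : E [⋀^Fin (2 * p + 2 * t)]→L[ℝ] ℂ}
    (hx : x ∈ hodgeClassesIn Φ (2 * p + 2 * t) (p + t)) : kleimanDualPow η (2 * p) t x ∈ hodgeClasses Φ p :=
  kleimanDualPow_apply_mem_hodgeClassesIn Φ hη hnd (2 * p) p t hx

/-- **`∗` above the middle degree is defined over `ℚ`.** [cite: Milne1999LefschetzClasses, §5 p. 665] -/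
theorem lefschetzStarInv_apply_mem_rationalForms (hη : IsNSForm Φ η)
    (hnd : ∀ v : E, v ≠ 0 → ∃ w : E, η ![v, w] ≠ 0) (m j : ℕ) {x : E [⋀^Fin (m + 2 * j)]→L[ℝ] ℂ}
    (hx : x ∈ rationalForms Φ (m + 2 * j)) : lefschetzStarInv η m j x ∈ rationalForms Φ m :=
  lefschetzSignOp_apply_mem_rationalForms Φ hη hnd (kleimanDualPow_apply_mem_rationalForms Φ hη hnd m j hx)

/-- **`∗` above the middle degree maps Hodge classes to Hodge classes**: `∗(H^{2(p+j)}_Hodge) ⊆ H^{2p}_Hodge`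
(source read in degree `2p + 2j`). [cite: Milne1999LefschetzClasses, §5 p. 665] [cite: Voisin2002, §6.2.3 Rem. 6.27] -/
theorem lefschetzStarInv_apply_mem_hodgeClasses (hη : IsNSForm Φ η)
    (hnd : ∀ v : E, v ≠ 0 → ∃ w : E, η ![v, w] ≠ 0) (p j : ℕ) {x : E [⋀^Fin (2 * p + 2 * j)]→L[ℝ] ℂ}
    (hx : x ∈ hodgeClassesIn Φ (2 * p + 2 * j) (p + j)) : lefschetzStarInv η (2 * p) j x ∈ hodgeClasses Φ p :=
  lefschetzSignOp_apply_mem_hodgeClasses Φ hη hnd (kleimanDualPow_apply_mem_hodgeClasses Φ hη hnd p j hx)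

end Rational

end ComplexTorus

end Literature.Geometry.Kaehler
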